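import Summits.AtomisticToContinuum.FouriersLaw.Theorems.OddSectorIrreversibilityWitnessGlueTangent

/-!
# `WitnessGlue` (stmt-AtomisticToContinuum-14072) — support 5: the transport-witness inequality

Support file for `OddSectorIrreversibility.WitnessGlue`: the pairing of the odd part `u⁻` of a
square-integrable function with the witness `W = w - w∘Θ`, `w = ∫_{(0,τ]} J_{[k₁,k₂)}∘Φ_t dt` the
time window of ONE block current along the closed flow. Θ-invariance of the Gibbs weight, Fubini,
and Cauchy–Schwarz give `witness_inequality`:
`(k₂ - k₁)(s τ - L τ²/2) ≤ ‖u‖_{L²(μ_T)} ‖w‖_{L²(μ_T)}` whenever every bond of the block pairs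
statically with `u` to `s` and its transported pairing leaks at rate at most `L`. No route
statement is asserted.
-/

noncomputable section

namespace Summit.AtomisticToContinuum.FouriersLaw.Theorems.OddSectorWitness

open MeasureTheory Filter Topology ProbabilityTheory Set
open scoped NNReal ENNReal
open Literature.MathematicalPhysics.KineticTheory.HeatConduction
open Summit.AtomisticToContinuum.FouriersLaw.Theorems.ClosedConeSensitivity.Negative.ZeroFrictionDictionary

variable {ω₂ lam β : ℝ} (hω : 0 < ω₂) (hl : 0 ≤ lam) (hβ : 0 ≤ β)
include hω hl hβ

/-! ## The transport-witness pairing (one central block, one window) -/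

section Pairing

variable (γ : ℝ) (N : ℕ) {T : ℝ}

omit hω hl hβ in
/-- Square integrability is preserved by the momentum reversal. [folklore] -/
theorem memLp_comp_momentumReversal {f : PhaseSpace N → ℝ} (hf : MemLp f 2 (gibbsWeight ω₂ lam β γ N T)) :
    MemLp (fun x : PhaseSpace N => f (x.1, -x.2)) 2 (gibbsWeight ω₂ lam β γ N T) :=
  hf.comp_measurePreserving (measurePreserving_momentumReversal_gibbsWeight γ N T)

omit hω hl hβ in
/-- The integral of the square is preserved by the momentum reversal. [folklore] -/
theorem integral_sq_comp_momentumReversal (f : PhaseSpace N → ℝ) :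
    ∫ x, (f (x.1, -x.2)) ^ 2 ∂(gibbsWeight ω₂ lam β γ N T) = ∫ x, (f x) ^ 2 ∂(gibbsWeight ω₂ lam β γ N T) :=
  integral_comp_momentumReversal_gibbsWeight γ N T (fun x => (f x) ^ 2)

omit hω hl hβ in
/-- The odd part `u⁻ = (u - u∘Θ)/2` of a square-integrable function is square integrable. [folklore] -/
theorem memLp_oddPart {u : PhaseSpace N → ℝ} (hu : MemLp u 2 (gibbsWeight ω₂ lam β γ N T)) :
    MemLp (fun x : PhaseSpace N => (u x - u (x.1, -x.2)) / 2) 2 (gibbsWeight ω₂ lam β γ N T) := by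
  have h := (hu.sub (memLp_comp_momentumReversal γ N hu)).const_mul (1 / 2 : ℝ)
  refine h.ae_eq (Eventually.of_forall fun x => ?_)
  simp only [Pi.sub_apply]
  ring

omit hω hl hβ in
/-- `∫ (u⁻)² ≤ ∫ u²`. [folklore] -/
theorem integral_sq_oddPart_le {u : PhaseSpace N → ℝ} (hu : MemLp u 2 (gibbsWeight ω₂ lam β γ N T)) :
    ∫ x, ((u x - u (x.1, -x.2)) / 2) ^ 2 ∂(gibbsWeight ω₂ lam β γ N T) ≤
      ∫ x, (u x) ^ 2 ∂(gibbsWeight ω₂ lam β γ N T) := by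
  have h1 : Integrable (fun x => (u x) ^ 2) (gibbsWeight ω₂ lam β γ N T) :=
    (memLp_two_iff_integrable_sq hu.aestronglyMeasurable).1 hu
  have h2 : Integrable (fun x => (u (x.1, -x.2)) ^ 2) (gibbsWeight ω₂ lam β γ N T) :=
    (memLp_two_iff_integrable_sq (memLp_comp_momentumReversal γ N hu).aestronglyMeasurable).1
      (memLp_comp_momentumReversal γ N hu)
  calc ∫ x, ((u x - u (x.1, -x.2)) / 2) ^ 2 ∂(gibbsWeight ω₂ lam β γ N T)
      ≤ ∫ x, ((u x) ^ 2 + (u (x.1, -x.2)) ^ 2) / 2 ∂(gibbsWeight ω₂ lam β γ N T) := by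
        refine integral_mono_of_nonneg (Eventually.of_forall fun x => sq_nonneg _) ((h1.add h2).div_const 2)
          (Eventually.of_forall fun x => ?_)
        nlinarith [sq_nonneg (u x + u (x.1, -x.2))]
    _ = ∫ x, (u x) ^ 2 ∂(gibbsWeight ω₂ lam β γ N T) := by
        rw [integral_div, integral_add h1 h2, integral_sq_comp_momentumReversal γ N u]
        ring

omit hω hl hβ in
/-- Pairing an odd function with a reversed observable flips the sign:
`∫ u⁻(x) g(Θx) dμ_T = -∫ u⁻ g dμ_T`. [folklore] -/
theorem integral_oddPart_mul_comp_momentumReversal (u g : PhaseSpace N → ℝ) :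
    ∫ x, (u x - u (x.1, -x.2)) / 2 * g (x.1, -x.2) ∂(gibbsWeight ω₂ lam β γ N T) =
      -∫ x, (u x - u (x.1, -x.2)) / 2 * g x ∂(gibbsWeight ω₂ lam β γ N T) := by
  have h := integral_comp_momentumReversal_gibbsWeight (ω₂ := ω₂) (lam := lam) (β := β) γ N T
    (fun x => (u (x.1, -x.2) - u x) / 2 * g x)
  simp only [neg_neg, Prod.mk.eta] at h
  rw [h, ← integral_neg]
  refine integral_congr_ae (Eventually.of_forall fun x => ?_)
  ring

omit hω hl hβ in
/-- Pairing an odd function with an odd observable: `∫ u⁻ g = ∫ u g` when `g∘Θ = -g`. [folklore] -/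
theorem integral_oddPart_mul_of_odd {u g : PhaseSpace N → ℝ} (hg : ∀ x : PhaseSpace N, g (x.1, -x.2) = -g x)
    (hu : MemLp u 2 (gibbsWeight ω₂ lam β γ N T)) (hg2 : MemLp g 2 (gibbsWeight ω₂ lam β γ N T)) :
    ∫ x, (u x - u (x.1, -x.2)) / 2 * g x ∂(gibbsWeight ω₂ lam β γ N T) =
      ∫ x, u x * g x ∂(gibbsWeight ω₂ lam β γ N T) := by
  have h := integral_comp_momentumReversal_gibbsWeight (ω₂ := ω₂) (lam := lam) (β := β) γ N T
    (fun x => u x * g (x.1, -x.2))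
  simp only [neg_neg, Prod.mk.eta] at h
  -- `h : ∫ u(Θx) g(x) = ∫ u(x) g(Θx) = -∫ u g`
  have h' : ∫ x, u (x.1, -x.2) * g x ∂(gibbsWeight ω₂ lam β γ N T) = -∫ x, u x * g x ∂(gibbsWeight ω₂ lam β γ N T) := by
    rw [h, ← integral_neg]
    refine integral_congr_ae (Eventually.of_forall fun x => ?_)
    show u x * g (x.1, -x.2) = -(u x * g x)
    rw [hg x]; ring
  have hi1 : Integrable (fun x => u x * g x) (gibbsWeight ω₂ lam β γ N T) := hu.integrable_mul hg2
  have hi2 : Integrable (fun x => u (x.1, -x.2) * g x) (gibbsWeight ω₂ lam β γ N T) :=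
    (memLp_comp_momentumReversal γ N hu).integrable_mul hg2
  calc ∫ x, (u x - u (x.1, -x.2)) / 2 * g x ∂(gibbsWeight ω₂ lam β γ N T)
      = ∫ x, ((u x * g x) - (u (x.1, -x.2) * g x)) / 2 ∂(gibbsWeight ω₂ lam β γ N T) :=
        integral_congr_ae (Eventually.of_forall fun x => by ring)
    _ = ((∫ x, u x * g x ∂(gibbsWeight ω₂ lam β γ N T)) - ∫ x, u (x.1, -x.2) * g x ∂(gibbsWeight ω₂ lam β γ N T)) / 2 := by
        rw [integral_div, integral_sub hi1 hi2]
    _ = _ := by rw [h']; ring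

omit hω hl hβ in
/-- The number of bonds in the block `[k₁, k₂)` of an `N`-site chain (`k₂ ≤ N`). [folklore] -/
theorem card_block {k₁ k₂ : ℕ} (hk₂ : k₂ ≤ N) :
    (Finset.univ.filter (fun i : Fin N => k₁ ≤ i.val ∧ i.val < k₂)).card = k₂ - k₁ := by
  rw [← Nat.card_Ico k₁ k₂]
  refine Finset.card_bij (fun i _ => i.val) (fun i hi => ?_) (fun i _ j _ h => Fin.ext h) (fun m hm => ?_)
  · simp only [Finset.mem_filter, Finset.mem_univ, true_and] at hi
    simp [Finset.mem_Ico, hi]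
  · simp only [Finset.mem_Ico] at hm
    exact ⟨⟨m, by omega⟩, by simp [hm], rfl⟩

/-- Each bond current is odd under the momentum reversal and square integrable; so is its transport
along the closed flow. [folklore] -/
theorem memLp_bondCurrent_detFlow (hT : 0 < T) (i : Fin N) (t : ℝ) :
    MemLp (fun x => (pinnedChain ω₂ lam β γ).bondCurrent N i (detFlow ω₂ lam β N t x)) 2 (gibbsWeight ω₂ lam β γ N T) :=
  memLp_two_of_abs_le_pow hω hl hβ γ N hT
    (((pinnedChain_continuous_bondCurrent ω₂ lam β γ N i).comp (continuous_detFlow hω hl hβ N t)).aestronglyMeasurable)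
    (N * ((3 + β) / 2)) 2 fun x => by
      have := abs_bondCurrent_detFlow_le hω hl hβ N γ i t x
      linarith [this]

/-- The bond current itself is square integrable (time `0` of the previous lemma). [folklore] -/
theorem memLp_bondCurrent (hT : 0 < T) (i : Fin N) :
    MemLp ((pinnedChain ω₂ lam β γ).bondCurrent N i) 2 (gibbsWeight ω₂ lam β γ N T) := by
  have h := memLp_bondCurrent_detFlow hω hl hβ γ N hT i 0
  simp only [detFlow_of_nonpos N le_rfl] at h
  exact h

/-- **The transport-witness inequality (one block, one window).** Let `u ∈ L²(μ_T)`, a block of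
bonds `[k₁, k₂)` (`k₁ ≤ k₂ ≤ N`), a window `τ ≥ 0`, a common static pairing
`s = ⟨u, j_i⟩_{μ_T}` of the block's bonds, and a leak rate `L ≥ 0` with
`⟨u⁻, j_i∘Φ_t⟩ ≥ ⟨u⁻, j_i⟩ - L t` on `0 < t ≤ τ`. Pairing `u⁻` with the witness `w - w∘Θ`,
`w = ∫_{(0,τ]} J_{[k₁,k₂)}∘Φ_t dt`, gives
`(k₂ - k₁)(s τ - L τ²/2) ≤ ‖u‖_{L²(μ_T)} · ‖w‖_{L²(μ_T)}`
(Θ-invariance, Fubini, Cauchy–Schwarz). [folklore] -/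
theorem witness_inequality (hT : 0 < T) {u : PhaseSpace N → ℝ} (hu : MemLp u 2 (gibbsWeight ω₂ lam β γ N T))
    {k₁ k₂ : ℕ} (hk : k₁ ≤ k₂) (hk₂ : k₂ ≤ N) {τ s L : ℝ} (hτ : 0 ≤ τ)
    (hS : ∀ i : Fin N, k₁ ≤ i.val → i.val < k₂ →
      ∫ x, u x * (pinnedChain ω₂ lam β γ).bondCurrent N i x ∂(gibbsWeight ω₂ lam β γ N T) = s)
    (hLeak : ∀ i : Fin N, k₁ ≤ i.val → i.val < k₂ → ∀ t : ℝ, 0 < t → t ≤ τ →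
      ∫ x, (u x - u (x.1, -x.2)) / 2 * (pinnedChain ω₂ lam β γ).bondCurrent N i x ∂(gibbsWeight ω₂ lam β γ N T) - L * t ≤
        ∫ x, (u x - u (x.1, -x.2)) / 2 * (pinnedChain ω₂ lam β γ).bondCurrent N i (detFlow ω₂ lam β N t x)
          ∂(gibbsWeight ω₂ lam β γ N T)) :
    ((k₂ : ℝ) - k₁) * (s * τ - L * τ ^ 2 / 2) ≤
      Real.sqrt (∫ x, (u x) ^ 2 ∂(gibbsWeight ω₂ lam β γ N T)) *
        Real.sqrt (∫ x, (window ω₂ lam β γ N k₁ k₂ τ x) ^ 2 ∂(gibbsWeight ω₂ lam β γ N T)) := by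
  haveI := isFiniteMeasure_gibbsWeight hω hl hβ γ N hT
  set P := pinnedChain ω₂ lam β γ
  set μ := gibbsWeight ω₂ lam β γ N T
  set uo : PhaseSpace N → ℝ := fun x => (u x - u (x.1, -x.2)) / 2 with huo
  set w := window ω₂ lam β γ N k₁ k₂ τ with hw_def
  set B := Finset.univ.filter (fun i : Fin N => k₁ ≤ i.val ∧ i.val < k₂) with hB
  have hcard : (B.card : ℝ) = (k₂ : ℝ) - k₁ := by
    rw [hB, card_block N hk₂, Nat.cast_sub hk]
  have huo2 : MemLp uo 2 μ := memLp_oddPart γ N hu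
  have hw2 : MemLp w 2 μ := memLp_two_window hω hl hβ N γ k₁ k₂ hτ hT
  have hwΘ2 : MemLp (fun x => w (x.1, -x.2)) 2 μ := memLp_comp_momentumReversal γ N hw2
  -- (1) pairing with the witness = twice the pairing with the window
  have h1 : ∫ x, uo x * (w x - w (x.1, -x.2)) ∂μ = 2 * ∫ x, uo x * w x ∂μ := by
    have hi1 : Integrable (fun x => uo x * w x) μ := huo2.integrable_mul hw2
    have hi2 : Integrable (fun x => uo x * w (x.1, -x.2)) μ := huo2.integrable_mul hwΘ2
    have hodd := integral_oddPart_mul_comp_momentumReversal (ω₂ := ω₂) (lam := lam) (β := β) (T := T) γ N u w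
    calc ∫ x, uo x * (w x - w (x.1, -x.2)) ∂μ = ∫ x, (uo x * w x - uo x * w (x.1, -x.2)) ∂μ :=
          integral_congr_ae (Eventually.of_forall fun x => by ring)
      _ = (∫ x, uo x * w x ∂μ) - ∫ x, uo x * w (x.1, -x.2) ∂μ := integral_sub hi1 hi2
      _ = 2 * ∫ x, uo x * w x ∂μ := by rw [huo]; rw [hodd]; ring
  -- (2) Fubini
  have hG : Measurable fun p : ℝ × PhaseSpace N => blockCurrent ω₂ lam β γ N k₁ k₂ (detFlow ω₂ lam β N p.1 p.2) :=
    measurable_blockCurrent_detFlow hω hl hβ N γ k₁ k₂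
  have h2 := integral_mul_setIntegral_eq hω hl hβ N γ hT τ huo2 hG (N * (N * ((3 + β) / 2))) 2
    (fun t x => by
      have := abs_blockCurrent_detFlow_le hω hl hβ N γ k₁ k₂ t x
      linarith [this])
  have h2eq : ∫ x, uo x * w x ∂μ = ∫ t in Ioc (0 : ℝ) τ, ∫ x, uo x * blockCurrent ω₂ lam β γ N k₁ k₂ (detFlow ω₂ lam β N t x) ∂μ :=
    h2.1
  -- (3) the inner pairing, bond by bond
  have h3 : ∀ t ∈ Ioc (0 : ℝ) τ, (B.card : ℝ) * (s - L * t) ≤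
      ∫ x, uo x * blockCurrent ω₂ lam β γ N k₁ k₂ (detFlow ω₂ lam β N t x) ∂μ := by
    intro t ht
    have hint : ∀ i : Fin N, Integrable (fun x => uo x * P.bondCurrent N i (detFlow ω₂ lam β N t x)) μ := fun i =>
      huo2.integrable_mul (memLp_bondCurrent_detFlow hω hl hβ γ N hT i t)
    have hsum : ∫ x, uo x * blockCurrent ω₂ lam β γ N k₁ k₂ (detFlow ω₂ lam β N t x) ∂μ =
        ∑ i : Fin N, (if k₁ ≤ i.val ∧ i.val < k₂ then ∫ x, uo x * P.bondCurrent N i (detFlow ω₂ lam β N t x) ∂μ else 0) := by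
      unfold blockCurrent
      simp_rw [Finset.mul_sum]
      rw [integral_finsetSum _ (fun i _ => ?_)]
      · refine Finset.sum_congr rfl fun i _ => ?_
        split_ifs with h
        · rfl
        · simp
      · split_ifs
        · exact hint i
        · simp
    rw [hsum, ← Finset.sum_filter, ← hB]
    have hterm : ∀ i ∈ B, s - L * t ≤ ∫ x, uo x * P.bondCurrent N i (detFlow ω₂ lam β N t x) ∂μ := by
      intro i hi
      rw [hB, Finset.mem_filter] at hi
      have hL := hLeak i hi.2.1 hi.2.2 t ht.1 ht.2
      have hodd := integral_oddPart_mul_of_odd (ω₂ := ω₂) (lam := lam) (β := β) γ N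
        (fun x => P.bondCurrent_neg_momentum N i x) hu (memLp_bondCurrent hω hl hβ γ N hT i)
      rw [hodd, hS i hi.2.1 hi.2.2] at hL
      exact hL
    calc (B.card : ℝ) * (s - L * t) = ∑ _i ∈ B, (s - L * t) := by rw [Finset.sum_const, nsmul_eq_mul]
      _ ≤ _ := Finset.sum_le_sum hterm
  -- (4) integrate the lower bound in time
  have h4 : (B.card : ℝ) * (s * τ - L * τ ^ 2 / 2) ≤ ∫ x, uo x * w x ∂μ := by
    rw [h2eq]
    have hpoly : IntegrableOn (fun t : ℝ => (B.card : ℝ) * (s - L * t)) (Ioc (0 : ℝ) τ) :=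
      (Continuous.integrableOn_Icc (by fun_prop)).mono_set Ioc_subset_Icc_self
    have hle := setIntegral_mono_on hpoly h2.2 measurableSet_Ioc h3
    refine le_trans (le_of_eq ?_) hle
    have hI : ∫ x in (0 : ℝ)..τ, (s - L * x) = s * τ - L * τ ^ 2 / 2 := by
      have hg : IntervalIntegrable (fun x : ℝ => L * x) volume 0 τ :=
        (show Continuous (fun x : ℝ => L * x) by fun_prop).intervalIntegrable 0 τ
      rw [intervalIntegral.integral_sub intervalIntegrable_const hg, intervalIntegral.integral_const,
        intervalIntegral.integral_const_mul, integral_id]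
      simp only [smul_eq_mul, sub_zero]
      ring
    rw [← intervalIntegral.integral_of_le hτ, intervalIntegral.integral_const_mul, hI]
  -- (5) Cauchy–Schwarz upper bound
  have h5 : ∫ x, uo x * (w x - w (x.1, -x.2)) ∂μ ≤
      Real.sqrt (∫ x, (u x) ^ 2 ∂μ) * (2 * Real.sqrt (∫ x, (w x) ^ 2 ∂μ)) := by
    have hcs := abs_integral_mul_le_sqrt huo2 (hw2.sub hwΘ2)
    simp only [Pi.sub_apply] at hcs
    refine (le_abs_self _).trans (hcs.trans ?_)
    have ha : Real.sqrt (∫ x, (uo x) ^ 2 ∂μ) ≤ Real.sqrt (∫ x, (u x) ^ 2 ∂μ) :=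
      Real.sqrt_le_sqrt (integral_sq_oddPart_le γ N hu)
    have hb : Real.sqrt (∫ x, (w x - w (x.1, -x.2)) ^ 2 ∂μ) ≤ 2 * Real.sqrt (∫ x, (w x) ^ 2 ∂μ) := by
      have hi1 : Integrable (fun x => (w x) ^ 2) μ := (memLp_two_iff_integrable_sq hw2.aestronglyMeasurable).1 hw2
      have hi2 : Integrable (fun x => (w (x.1, -x.2)) ^ 2) μ :=
        (memLp_two_iff_integrable_sq hwΘ2.aestronglyMeasurable).1 hwΘ2
      have hle : ∫ x, (w x - w (x.1, -x.2)) ^ 2 ∂μ ≤ 4 * ∫ x, (w x) ^ 2 ∂μ := by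
        calc ∫ x, (w x - w (x.1, -x.2)) ^ 2 ∂μ ≤ ∫ x, (2 * (w x) ^ 2 + 2 * (w (x.1, -x.2)) ^ 2) ∂μ := by
              refine integral_mono_of_nonneg (Eventually.of_forall fun x => sq_nonneg _)
                ((hi1.const_mul 2).add (hi2.const_mul 2)) (Eventually.of_forall fun x => ?_)
              nlinarith [sq_nonneg (w x + w (x.1, -x.2))]
          _ = 4 * ∫ x, (w x) ^ 2 ∂μ := by
              rw [integral_add (hi1.const_mul 2) (hi2.const_mul 2), integral_const_mul, integral_const_mul,
                integral_sq_comp_momentumReversal γ N w]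
              ring
      calc Real.sqrt (∫ x, (w x - w (x.1, -x.2)) ^ 2 ∂μ) ≤ Real.sqrt (4 * ∫ x, (w x) ^ 2 ∂μ) := Real.sqrt_le_sqrt hle
        _ = 2 * Real.sqrt (∫ x, (w x) ^ 2 ∂μ) := by
            rw [Real.sqrt_mul (by norm_num), show (4 : ℝ) = 2 ^ 2 by norm_num, Real.sqrt_sq (by norm_num)]
    exact mul_le_mul ha hb (Real.sqrt_nonneg _) (Real.sqrt_nonneg _)
  -- (6) combine
  rw [← hcard]
  have h6 : 2 * ∫ x, uo x * w x ∂μ ≤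
      Real.sqrt (∫ x, (u x) ^ 2 ∂μ) * (2 * Real.sqrt (∫ x, (w x) ^ 2 ∂μ)) := h1 ▸ h5
  calc (B.card : ℝ) * (s * τ - L * τ ^ 2 / 2) ≤ ∫ x, uo x * w x ∂μ := h4
    _ ≤ _ := by linarith

end Pairing

end Summit.AtomisticToContinuum.FouriersLaw.Theorems.OddSectorWitness
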